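import Mathlib

/-!
# Route `GreenTaoLevelTwo`, crux `MNTwo` (stmt-Parity-21276), line `birth`, stub `stub_mnVertical`:
# discarding a slowly varying weight from a short progression sum (GT 2008b §10, Lemma 23)

Tool for block V4 (= AIF §10) of the `stub_mnVertical` census (B. Green, T. Tao, *Quadratic
uniformity of the Möbius function*, Ann. Inst. Fourier 58 (2008) = arXiv:math/0606087, proof of
Lemma 23: "By (lip) we have `ψ(dw + dtl) = ψ(dw) + O(l‖dt‖_g) = ψ(dw) + O(ε)` and hence …
`|𝔼_{1≤l≤L} ψ(dw) e(φ(dw+dtl))| ≳ 1`.  Since `ψ(dw)` is bounded and independent of `l`, it can be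
discarded"; the same step occurs in Lemma 24 in both variables).  Def-free, for a finite index set:

* `sum_weight_mul_eq` — `∑ u(l)c(l) = u₀ ∑ c(l) + ∑ (u(l) − u₀) c(l)`;
* `norm_sum_weight_mul_le` — `‖∑ u(l)c(l)‖ ≤ |u₀|‖∑ c(l)‖ + ∑ |u(l) − u₀|‖c(l)‖`;
* `norm_sum_phase_ge_of_weight` — if `‖c(l)‖ ≤ 1`, `|u(l) − u₀| ≤ δ` on `s`, `|u₀| ≤ B` and
  `X ≤ ‖∑_s u(l)c(l)‖` then `X − δ·#s ≤ B‖∑_s c(l)‖`.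

References: [GreenTao2008QuadraticMobius] arXiv:math/0606087 §10 (proofs of Lemmas 23, 24).
-/

open Finset

namespace Summit.Parity.GeneralizedHardyLittlewood.GreenTaoLevelTwoMNTwoWeightRemoval

/-- `∑ u(l)c(l) = u₀ ∑ c(l) + ∑ (u(l) − u₀)c(l)`. [folklore] -/
theorem sum_weight_mul_eq {ι : Type*} (s : Finset ι) (u : ι → ℝ) (c : ι → ℂ) (u₀ : ℝ) :
    ∑ l ∈ s, (u l : ℂ) * c l = (u₀ : ℂ) * ∑ l ∈ s, c l + ∑ l ∈ s, ((u l - u₀ : ℝ) : ℂ) * c l := by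
  rw [mul_sum, ← sum_add_distrib]
  refine sum_congr rfl fun l _ => ?_
  push_cast
  ring

/-- `‖∑ u(l)c(l)‖ ≤ |u₀| ‖∑ c(l)‖ + ∑ |u(l) − u₀| ‖c(l)‖`. [folklore] -/
theorem norm_sum_weight_mul_le {ι : Type*} (s : Finset ι) (u : ι → ℝ) (c : ι → ℂ) (u₀ : ℝ) :
    ‖∑ l ∈ s, (u l : ℂ) * c l‖ ≤ |u₀| * ‖∑ l ∈ s, c l‖ + ∑ l ∈ s, |u l - u₀| * ‖c l‖ := by
  rw [sum_weight_mul_eq s u c u₀]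
  refine (norm_add_le _ _).trans (add_le_add ?_ ?_)
  · rw [norm_mul, Complex.norm_real, Real.norm_eq_abs]
  · refine (norm_sum_le _ _).trans (le_of_eq (sum_congr rfl fun l _ => ?_))
    rw [norm_mul, Complex.norm_real, Real.norm_eq_abs]

/-- **Discarding a slowly varying weight**: if `‖c(l)‖ ≤ 1` and `|u(l) − u₀| ≤ δ` on `s`,
`|u₀| ≤ B`, and `X ≤ ‖∑_s u(l)c(l)‖`, then `X − δ·#s ≤ B‖∑_s c(l)‖`.
[cite: GreenTao2008QuadraticMobius, §10 (proof of Lemma 23, "it can be discarded")] -/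
theorem norm_sum_phase_ge_of_weight {ι : Type*} (s : Finset ι) (u : ι → ℝ) (c : ι → ℂ)
    {u₀ δ B X : ℝ} (hc : ∀ l ∈ s, ‖c l‖ ≤ 1) (hu : ∀ l ∈ s, |u l - u₀| ≤ δ) (hB : |u₀| ≤ B)
    (hX : X ≤ ‖∑ l ∈ s, (u l : ℂ) * c l‖) :
    X - δ * #s ≤ B * ‖∑ l ∈ s, c l‖ := by
  have h1 := norm_sum_weight_mul_le s u c u₀
  have h2 : ∑ l ∈ s, |u l - u₀| * ‖c l‖ ≤ ∑ _l ∈ s, δ := sum_le_sum fun l hl => by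
    calc |u l - u₀| * ‖c l‖ ≤ δ * 1 :=
          mul_le_mul (hu l hl) (hc l hl) (norm_nonneg _) ((abs_nonneg _).trans (hu l hl))
      _ = δ := mul_one δ
  rw [sum_const, nsmul_eq_mul] at h2
  have h3 : |u₀| * ‖∑ l ∈ s, c l‖ ≤ B * ‖∑ l ∈ s, c l‖ :=
    mul_le_mul_of_nonneg_right hB (norm_nonneg _)
  linarith

end Summit.Parity.GeneralizedHardyLittlewood.GreenTaoLevelTwoMNTwoWeightRemoval
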